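import Mathlib
import HarnessLib

/-!
# Volkov's octave-ratio sentence as a theorem about any random variable (PRD 98 §IV.F): if the octave probabilities of |y| fall by less than a factor `2^r` per octave towards large |y|, the r-th absolute moment is infinite (`r = 2`: "the standard deviation is infinite"; `r = 3`: the Berry–Esseen footnote) — PROVED

independent recomputation; certified where stated, statistical where stated; no new-physics claim.

CITATION HEADER (venture `QEDPrecision`, cell `pub-qed`, track TROPICAL seat V3a = `pub-qed-trop-v3-lit-1` gen 8; VALUE-FREE: a statement about
an arbitrary measurable function on an arbitrary measure space; no constant of the paper beyond the octave thresholds 4 and 8, nothing per graph or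
per Set V family). Companion of `Volkov2018/ErrorEstimation.lean` (lit g21), which types §IV.F's σ↑/σ↓ formulas verbatim and proves the octave
sentence IN THE OCTAVE MODEL (`not_summable_of_ratio_lt`: the series Σ q_n cⁿ diverges); the step "r-th moment ≥ the octave series", stated
there in a docstring, is made a theorem HERE for a genuine random variable, so that the printed sentence holds for the law of the Monte-Carlo
weights y = I/g itself. Serves `tropical/view/V3-VOLKOV-DEGREES.md` §A A.0.4 / A.5.2 (the only printed VARIANCE criterion in Volkov 2015–2019)
and the tail-index readers' dictionary "octave ratio 2^α ↔ tail index α" (ratio < 4 ⇔ α < 2).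

Source [Volkov2018]: S. Volkov, "Numerical calculation of high-order QED contributions to the electron anomalous magnetic moment", Phys. Rev.
D 98, 076018 (2018) = arXiv:1807.05281v2, §IV.F "Monte Carlo error estimation" (e-print `amm4gpu_arxiv.tex` on the pub-qed HOME,
`data/lit/sources/.cache/1807.05281/`, l.1049–1089; arXiv v2 PDF p.20 — §IV.F text p.20–22, its Table I p.22–23), VERBATIM: "Let z₁,…,z_N be random samples … By definition, put
y_j = I(z)/g(z). … By definition, put maxlog = max_j ⌊log₂|y_j| + 0.5⌋, let n_k be the quantity of samples j such that
2^{maxlog−k−0.5} ≤ |y_j| < 2^{maxlog−k+0.5}. (eq_n_prob_def) … n_k is an approximation for N p_k, where p_k is the probability that a sample is in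
the interval (eq_n_prob_def). We can see that the real standard deviation is highly dependent on the behavior of p_j for j < 0. For example, if
p_{j+1}/p_j < 4 for all j < j₀ then the standard deviation is infinite [footnote: Table (distr_ladder) demonstrates that for the 6-loop ladder
such a situation is quite possible.]" and footnote l.1079–1089: "… the Berry-Esseen inequality uses the third central moment of random variables
that is infinite if p_{j+1}/p_j < 8 for all j < j₀ (Table (distr_ladder) shows that this situation is quite possible for both 5-loop and 6-loop
ladders)."

TYPING. `(Ω, μ)` any measure space, `y : Ω → ℝ` measurable (the weight I/g under the sampling law; the statement is law-level, so any model of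
it will do), `c : ℤ` the reference exponent (the printed `maxlog`; any integer), `octaveBin y c k = {2^{c−k−1/2} ≤ |y| < 2^{c−k+1/2}}` for
`k : ℤ` — the printed interval (eq_n_prob_def), `k` increasing towards SMALL |y| as printed (so "j < 0" / "j < j₀" are the octaves ABOVE the
reference), `p_k = μ (octaveBin y c k)`.
* `octaveBin_disjoint`, `measurableSet_octaveBin`;
* **`tsum_octave_le_lintegral_rpow`**: for every `r ≥ 0`, `Σ_k 2^{r(c−k−1/2)} · p_k ≤ ∫ |y|^r dμ` (on the k-th octave |y|^r ≥ (2^{c−k−1/2})^r; the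
  octaves are disjoint) — the docstring step of `ErrorEstimation.lean` ("second moment ≥ Σ_k p_k 4^{maxlog−k−1/2}") as a theorem;
* **`lintegral_rpow_eq_top_of_octaveRatio`**: if `p_{j₀} ≠ 0` and `p_{j+1} ≤ 2^r · p_j` for all `j < j₀` (`r > 0`), then `∫ |y|^r dμ = ∞` — each of
  the infinitely many octaves above `j₀` contributes at least `2^{r(c−j₀−1/2)} · p_{j₀}` (the hypothesis is the printed STRICT "<" weakened to "≤",
  which only strengthens the theorem; `p_{j₀} ≠ 0` is what "for all j < j₀" presupposes — with all p_j = 0 above some octave the sentence is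
  vacuous and the moment finite);
* `lintegral_sq_eq_top_of_octaveRatio_four` (`r = 2`, threshold 4: "the standard deviation is infinite" = E[y²] = ∞) and
  `lintegral_cube_eq_top_of_octaveRatio_eight` (`r = 3`, threshold 8: the third absolute moment, Berry–Esseen footnote); in general the
  threshold for the r-th moment is `2^r` (⟦reading used by the cell's tail-index seats: an asymptotic octave ratio 2^α is a tail index α, and
  ratio < 4 ⇔ α < 2⟧ — the equivalence itself is not claimed here, only the printed direction).
NOT typed: the converse (fast octave decay ⇒ finite moment — true with a margin, not printed), anything about the ESTIMATES n_k of p_k (sampling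
fluctuation, the σ↑ construction — `ErrorEstimation.lean`), and any statement about a particular integrand.
-/

namespace Literature.MathematicalPhysics.QuantumFieldTheory.Volkov2018

open MeasureTheory Set
open scoped ENNReal

variable {Ω : Type*}

/-- The printed octave (eq_n_prob_def): `2^{c−k−1/2} ≤ |y| < 2^{c−k+1/2}`, `k : ℤ` increasing towards small |y| (`c` = the printed maxlog).
[cite: Volkov2018, §IV.F eq. (eq_n_prob_def) (tex l.1065–1068)] -/
def octaveBin (y : Ω → ℝ) (c k : ℤ) : Set Ω :=
  (fun ω => |y ω|) ⁻¹' Ico ((2 : ℝ) ^ ((c : ℝ) - k - 1 / 2)) ((2 : ℝ) ^ ((c : ℝ) - k + 1 / 2))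

/-- Membership in the octave. [cite: Volkov2018, §IV.F eq. (eq_n_prob_def)] -/
theorem mem_octaveBin {y : Ω → ℝ} {c k : ℤ} {ω : Ω} :
    ω ∈ octaveBin y c k ↔ (2 : ℝ) ^ ((c : ℝ) - k - 1 / 2) ≤ |y ω| ∧ |y ω| < (2 : ℝ) ^ ((c : ℝ) - k + 1 / 2) :=
  Iff.rfl

/-- The octaves are measurable for measurable `y`. [cite: Volkov2018, §IV.F eq. (eq_n_prob_def)] -/
theorem measurableSet_octaveBin [MeasurableSpace Ω] {y : Ω → ℝ} (hy : Measurable y) (c k : ℤ) :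
    MeasurableSet (octaveBin y c k) :=
  (hy.abs) measurableSet_Ico

/-- Distinct octaves are disjoint (the upper edge of octave `k + 1` is the lower edge of octave `k`).
[cite: Volkov2018, §IV.F eq. (eq_n_prob_def)] -/
theorem octaveBin_disjoint (y : Ω → ℝ) (c : ℤ) : Pairwise (Function.onFun Disjoint (octaveBin y c)) := by
  intro k k' hkk'
  wlog hlt : k < k' generalizing k k'
  · exact (this hkk'.symm (lt_of_le_of_ne (not_lt.mp hlt) hkk'.symm)).symm
  refine disjoint_left.mpr fun ω hω hω' => ?_
  rw [mem_octaveBin] at hω hω'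
  have hexp : (c : ℝ) - k' + 1 / 2 ≤ (c : ℝ) - k - 1 / 2 := by
    have : (k : ℝ) + 1 ≤ k' := by exact_mod_cast hlt
    linarith
  have hedge : (2 : ℝ) ^ ((c : ℝ) - k' + 1 / 2) ≤ (2 : ℝ) ^ ((c : ℝ) - k - 1 / 2) :=
    Real.rpow_le_rpow_of_exponent_le one_le_two hexp
  linarith [hω.1, hω'.2]

/-- On the `k`-th octave `|y|^r ≥ 2^{r(c−k−1/2)}` (`r ≥ 0`). [cite: Volkov2018, §IV.F eq. (eq_n_prob_def)] -/
theorem rpow_le_of_mem_octaveBin {y : Ω → ℝ} {c k : ℤ} {ω : Ω} (hω : ω ∈ octaveBin y c k) {r : ℝ} (hr : 0 ≤ r) :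
    (2 : ℝ) ^ (r * ((c : ℝ) - k - 1 / 2)) ≤ |y ω| ^ r := by
  rw [mul_comm, Real.rpow_mul zero_le_two]
  exact Real.rpow_le_rpow (Real.rpow_nonneg zero_le_two _) hω.1 hr

variable [MeasurableSpace Ω]

/-- **The r-th absolute moment dominates the octave series**: `Σ_{k∈ℤ} 2^{r(c−k−1/2)} · μ(octave k) ≤ ∫ |y|^r dμ` for every `r ≥ 0` and every
measurable `y` ("the real standard deviation is highly dependent on the behavior of p_j for j < 0"; the docstring step "second moment ≥
Σ_k p_k 4^{maxlog−k−1/2}" of `ErrorEstimation.lean`). [cite: Volkov2018, §IV.F (tex l.1072–1077)] -/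
theorem tsum_octave_le_lintegral_rpow {μ : Measure Ω} {y : Ω → ℝ} (hy : Measurable y) (c : ℤ) {r : ℝ} (hr : 0 ≤ r) :
    ∑' k : ℤ, ENNReal.ofReal ((2 : ℝ) ^ (r * ((c : ℝ) - k - 1 / 2))) * μ (octaveBin y c k) ≤
      ∫⁻ ω, ENNReal.ofReal (|y ω| ^ r) ∂μ := by
  calc ∑' k : ℤ, ENNReal.ofReal ((2 : ℝ) ^ (r * ((c : ℝ) - k - 1 / 2))) * μ (octaveBin y c k)
      = ∑' k : ℤ, ∫⁻ _ in octaveBin y c k, ENNReal.ofReal ((2 : ℝ) ^ (r * ((c : ℝ) - k - 1 / 2))) ∂μ := by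
        refine tsum_congr fun k => ?_
        rw [setLIntegral_const]
    _ ≤ ∑' k : ℤ, ∫⁻ ω in octaveBin y c k, ENNReal.ofReal (|y ω| ^ r) ∂μ := by
        refine ENNReal.tsum_le_tsum fun k => setLIntegral_mono' (measurableSet_octaveBin hy c k) fun ω hω => ?_
        exact ENNReal.ofReal_le_ofReal (rpow_le_of_mem_octaveBin hω hr)
    _ = ∫⁻ ω in ⋃ k, octaveBin y c k, ENNReal.ofReal (|y ω| ^ r) ∂μ :=
        (lintegral_iUnion (measurableSet_octaveBin hy c) (octaveBin_disjoint y c) _).symm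
    _ ≤ ∫⁻ ω, ENNReal.ofReal (|y ω| ^ r) ∂μ := setLIntegral_le_lintegral _ _

/-- Downward propagation of the printed ratio hypothesis: if `p_{j+1} ≤ 2^r p_j` for all `j < j₀` then `p_{j₀} ≤ (2^r)^n · p_{j₀−n}`.
[cite: Volkov2018, §IV.F ("if p_{j+1}/p_j < 4 for all j < j₀")] -/
theorem measure_octaveBin_le_of_ratio {μ : Measure Ω} {y : Ω → ℝ} {c j₀ : ℤ} {q : ℝ≥0∞}
    (hratio : ∀ j : ℤ, j < j₀ → μ (octaveBin y c (j + 1)) ≤ q * μ (octaveBin y c j)) (n : ℕ) :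
    μ (octaveBin y c j₀) ≤ q ^ n * μ (octaveBin y c (j₀ - n)) := by
  induction n with
  | zero => simp
  | succ n ih =>
    have hj : j₀ - (n + 1 : ℕ) < j₀ := by omega
    have hstep := hratio (j₀ - (n + 1 : ℕ)) hj
    have heq : j₀ - (n + 1 : ℕ) + 1 = j₀ - n := by omega
    rw [heq] at hstep
    calc μ (octaveBin y c j₀) ≤ q ^ n * μ (octaveBin y c (j₀ - n)) := ih
      _ ≤ q ^ n * (q * μ (octaveBin y c (j₀ - (n + 1 : ℕ)))) := by gcongr
      _ = q ^ (n + 1) * μ (octaveBin y c (j₀ - (n + 1 : ℕ))) := by rw [pow_succ, mul_assoc]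

/-- **The printed sentence, for any law and any moment order**: if the octave probabilities of |y| satisfy `p_{j+1} ≤ 2^r · p_j` for all
`j < j₀` (they fall by at most a factor `2^r` per octave towards LARGE |y|) and `p_{j₀} ≠ 0`, then `∫ |y|^r dμ = ∞` (`r > 0`). Route: by
`measure_octaveBin_le_of_ratio` the octave `j₀ − n` carries probability ≥ p_{j₀}/2^{rn} while |y|^r ≥ 2^{r(c−j₀+n−1/2)} on it, so each of the
infinitely many octaves above `j₀` contributes at least `2^{r(c−j₀−1/2)} · p_{j₀}` to `tsum_octave_le_lintegral_rpow`.
[cite: Volkov2018, §IV.F ("if p_{j+1}/p_j < 4 for all j < j₀ then the standard deviation is infinite"; footnote "< 8", third moment)] -/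
theorem lintegral_rpow_eq_top_of_octaveRatio {μ : Measure Ω} {y : Ω → ℝ} (hy : Measurable y) {c j₀ : ℤ} {r : ℝ} (hr : 0 < r)
    (hpos : μ (octaveBin y c j₀) ≠ 0)
    (hratio : ∀ j : ℤ, j < j₀ → μ (octaveBin y c (j + 1)) ≤ ENNReal.ofReal ((2 : ℝ) ^ r) * μ (octaveBin y c j)) :
    ∫⁻ ω, ENNReal.ofReal (|y ω| ^ r) ∂μ = ∞ := by
  set ε : ℝ≥0∞ := ENNReal.ofReal ((2 : ℝ) ^ (r * ((c : ℝ) - j₀ - 1 / 2))) * μ (octaveBin y c j₀) with hε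
  have hεne : ε ≠ 0 := mul_ne_zero (by positivity) hpos
  -- each octave above j₀ contributes at least ε
  have hterm : ∀ n : ℕ, ε ≤ ENNReal.ofReal ((2 : ℝ) ^ (r * ((c : ℝ) - (j₀ - n : ℤ) - 1 / 2))) * μ (octaveBin y c (j₀ - n)) := by
    intro n
    have hsplit : (2 : ℝ) ^ (r * ((c : ℝ) - (j₀ - n : ℤ) - 1 / 2)) = (2 : ℝ) ^ (r * ((c : ℝ) - j₀ - 1 / 2)) * ((2 : ℝ) ^ r) ^ n := by
      rw [← Real.rpow_natCast ((2 : ℝ) ^ r), ← Real.rpow_mul zero_le_two, ← Real.rpow_add two_pos]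
      congr 1
      push_cast
      ring
    rw [hsplit, ENNReal.ofReal_mul (by positivity), ENNReal.ofReal_pow (by positivity), mul_assoc, hε]
    gcongr
    exact measure_octaveBin_le_of_ratio hratio n
  -- sum over the octaves j₀ − n, n ∈ ℕ (an injective family of indices)
  have hinj : Function.Injective fun n : ℕ => j₀ - (n : ℤ) := fun a b h => by
    have : (a : ℤ) = b := by linarith [h]
    exact_mod_cast this
  have htop : ∑' k : ℤ, ENNReal.ofReal ((2 : ℝ) ^ (r * ((c : ℝ) - k - 1 / 2))) * μ (octaveBin y c k) = ∞ := by
    refine eq_top_iff.mpr ?_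
    calc (⊤ : ℝ≥0∞) = ∑' _ : ℕ, ε := (ENNReal.tsum_const_eq_top_of_ne_zero hεne).symm
      _ ≤ ∑' n : ℕ, ENNReal.ofReal ((2 : ℝ) ^ (r * ((c : ℝ) - (j₀ - n : ℤ) - 1 / 2))) * μ (octaveBin y c (j₀ - n)) :=
          ENNReal.tsum_le_tsum hterm
      _ ≤ ∑' k : ℤ, ENNReal.ofReal ((2 : ℝ) ^ (r * ((c : ℝ) - k - 1 / 2))) * μ (octaveBin y c k) :=
          ENNReal.tsum_comp_le_tsum_of_injective hinj
            (fun k : ℤ => ENNReal.ofReal ((2 : ℝ) ^ (r * ((c : ℝ) - k - 1 / 2))) * μ (octaveBin y c k))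
  exact eq_top_iff.mpr (htop ▸ tsum_octave_le_lintegral_rpow hy c hr.le)

/-- **"if p_{j+1}/p_j < 4 for all j < j₀ then the standard deviation is infinite"**: threshold `4 = 2²`, conclusion `∫ |y|² dμ = ∞`, i.e. the
second moment of the weights — and with it the variance of the Monte-Carlo mean at every sample size — is infinite (hypothesis in the weak form
`p_{j+1} ≤ 4 p_j`; `p_{j₀} ≠ 0`). [cite: Volkov2018, §IV.F (tex l.1072–1077)] -/
theorem lintegral_sq_eq_top_of_octaveRatio_four {μ : Measure Ω} {y : Ω → ℝ} (hy : Measurable y) {c j₀ : ℤ}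
    (hpos : μ (octaveBin y c j₀) ≠ 0)
    (hratio : ∀ j : ℤ, j < j₀ → μ (octaveBin y c (j + 1)) ≤ 4 * μ (octaveBin y c j)) :
    ∫⁻ ω, ENNReal.ofReal (|y ω| ^ (2 : ℝ)) ∂μ = ∞ := by
  have h4 : ENNReal.ofReal ((2 : ℝ) ^ (2 : ℝ)) = 4 := by
    rw [Real.rpow_two]
    norm_num
  exact lintegral_rpow_eq_top_of_octaveRatio hy two_pos hpos (fun j hj => h4.symm ▸ hratio j hj)

/-- **The Berry–Esseen footnote**: threshold `8 = 2³`, conclusion `∫ |y|³ dμ = ∞` (the third absolute moment; the printed "third central moment"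
is then infinite as well whenever the mean is finite — not typed). [cite: Volkov2018, §IV.F footnote (tex l.1079–1089)] -/
theorem lintegral_cube_eq_top_of_octaveRatio_eight {μ : Measure Ω} {y : Ω → ℝ} (hy : Measurable y) {c j₀ : ℤ}
    (hpos : μ (octaveBin y c j₀) ≠ 0)
    (hratio : ∀ j : ℤ, j < j₀ → μ (octaveBin y c (j + 1)) ≤ 8 * μ (octaveBin y c j)) :
    ∫⁻ ω, ENNReal.ofReal (|y ω| ^ (3 : ℝ)) ∂μ = ∞ := by
  have h8 : ENNReal.ofReal ((2 : ℝ) ^ (3 : ℝ)) = 8 := by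
    rw [show (3 : ℝ) = ((3 : ℕ) : ℝ) by norm_num, Real.rpow_natCast]
    norm_num
  exact lintegral_rpow_eq_top_of_octaveRatio hy three_pos hpos (fun j hj => h8.symm ▸ hratio j hj)

end Literature.MathematicalPhysics.QuantumFieldTheory.Volkov2018
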